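import Summits.MatrixMultiplication.MatrixMultiplication.Theorems.SoloInformedGroupDoor

/-!
# The group-theoretic door: classes a Cohn–Umans family cannot be drawn from

Companion to `SoloInformedGroupDoor.lean`.  A family of finite groups entering the door of
Cohn–Umans 2003, Cor. 4.3 eventually beats every `(2+ε)`-certificate bound
(`tppFamily_eventually_exists_tpp_beating`); every class of groups for which the tree proves a
uniform `(2+ε)`-certificate exclusion (BCGPU 2023, Thm. 3.2 and its corollaries; Sawin 2018) therefore
supports no such family.  Applied here (each as `… → False` from the Cor. 4.3 hypotheses):

* `no_tppFamily_GL` — `GL_{nᵢ}(Fᵢ)`, any `nᵢ ≥ 2`, any finite fields (`BCGPU2023_noCertificate_GL`);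
* `no_tppFamily_SL`, `no_tppFamily_PSL` — `SL_{nᵢ}(Fᵢ)`, `PSL_{nᵢ}(Fᵢ)`, any `nᵢ ≥ 2`
  (`BCGPU2023_cor34_typeA_holds`);
* `no_tppFamily_SL_pow` — `SL_n(Fᵢ)^k`, `n ≥ 2`, `k ≥ 1` fixed (`exists_eps_noCertificate_SL_pow`);
* `no_tppFamily_SL_pow_fixed_field` — `SL_n(F)^{kᵢ}`, `n ≥ 2`, `F` fixed
  (`exists_eps_noCertificate_SL_pow_fixed_field_tpp`);
* `no_tppFamily_pow_fixed_group` — `H^{kᵢ}` for one fixed non-trivial `H` (`Sawin2018_thm15_stpp`,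
  one-member STPP family).

Not excluded by anything in the tree (the open residual, from print): alternating groups
(`alternatingGroup_not_cor33_hypothesis`), `SL_n(𝔽_q)^m` with `q, m` both unbounded, subsets of
`∏ GL_{nᵢ}(𝔽_{qᵢ})` that are not subgroups, and the abelian two-families door
(`matrixMultiplication_of_twoFamilies`) in groups of unbounded exponent.

[cite: BlasiakCohnGrochowPrattUmans2023, Thm. 3.2, Cor. 3.4, §5]
[cite: Sawin2018, Thm. 1.5]
[cite: CohnUmans2003, Cor. 4.3]
-/

noncomputable section

namespace Summit.MatrixMultiplication.MatrixMultiplication.Theorems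

open Filter Topology
open scoped MatrixGroups
open Literature.Computability.AlgebraicComplexity
open Literature.RepresentationTheory.FiniteGroups Literature.Combinatorics.Additive
open Literature.Barriers.MatrixMultiplication

/-! ## §4 Classes a door family cannot be drawn from (the tree's proved exclusions, applied) -/

section Exclusions

/-- From an `(2+ε)`-certificate exclusion valid for every member of the family, the Cor. 4.3
hypotheses are contradictory. [cite: BlasiakCohnGrochowPrattUmans2023, Thm. 3.2]
[cite: CohnUmans2003, Cor. 4.3] -/
theorem tppFamily_false_of_noCertificate (G : ℕ → Type) [∀ i, Group (G i)] [∀ i, Finite (G i)]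
    (n m p d : ℕ → ℕ)
    (h : ∀ i, RealizesTPP (G i) (n i) (m i) (p i)) (hd : ∀ i, maxCharDegree (G i) ≤ d i)
    (hd2 : ∀ i, 2 ≤ d i) (hlt : ∀ i, d i ^ 3 < n i * m i * p i)
    (hα : Tendsto (fun i => 3 * Real.log (Nat.card (G i)) / Real.log ((n i * m i * p i : ℕ) : ℝ))
      atTop (𝓝 2))
    (ho : Tendsto (fun i => (3 * Real.log (Nat.card (G i)) / Real.log ((n i * m i * p i : ℕ) : ℝ) - 2) /
        (Real.log (Nat.card (G i)) / Real.log (d i) - 2)) atTop (𝓝 0))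
    {ε : ℝ} (hε : 0 < ε)
    (hcert : ∀ i, ∀ S T U : Finset (G i), TripleProductProperty S T U →
      ((S.card * T.card * U.card : ℕ) : ℝ) ^ ((2 + ε) / 3) ≤ charDegreePowSum (G i) (2 + ε)) :
    False := by
  obtain ⟨i, S, T, U, hTPP, hlt'⟩ :=
    (tppFamily_eventually_exists_tpp_beating G n m p d h hd hd2 hlt hα ho hε).exists
  have := hcert i S T U hTPP
  linarith

/-- **Not from `GL_n(𝔽_q)`** (any `nᵢ ≥ 2`, any finite fields `Fᵢ`): BCGPU 2023, Cor. 3.4 with the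
centre quotient argument, the tree's `BCGPU2023_noCertificate_GL`.
[cite: BlasiakCohnGrochowPrattUmans2023, Cor. 3.4, §5] -/
theorem no_tppFamily_GL (k : ℕ → ℕ) (hk : ∀ i, 2 ≤ k i)
    (F : ℕ → Type) [∀ i, Field (F i)] [∀ i, Fintype (F i)] (n m p d : ℕ → ℕ)
    (h : ∀ i, RealizesTPP (GL (Fin (k i)) (F i)) (n i) (m i) (p i))
    (hd : ∀ i, maxCharDegree (GL (Fin (k i)) (F i)) ≤ d i)
    (hd2 : ∀ i, 2 ≤ d i) (hlt : ∀ i, d i ^ 3 < n i * m i * p i)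
    (hα : Tendsto (fun i => 3 * Real.log (Nat.card (GL (Fin (k i)) (F i))) /
      Real.log ((n i * m i * p i : ℕ) : ℝ)) atTop (𝓝 2))
    (ho : Tendsto (fun i => (3 * Real.log (Nat.card (GL (Fin (k i)) (F i))) /
        Real.log ((n i * m i * p i : ℕ) : ℝ) - 2) /
        (Real.log (Nat.card (GL (Fin (k i)) (F i))) / Real.log (d i) - 2)) atTop (𝓝 0)) :
    False := by
  classical
  obtain ⟨ε, hε, hGL⟩ := BCGPU2023_noCertificate_GL
  exact tppFamily_false_of_noCertificate (fun i => GL (Fin (k i)) (F i)) n m p d h hd hd2 hlt hα ho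
    hε fun i S T U hTPP => hGL (F i) (k i) (hk i) S T U hTPP

/-- **Not from `SL_n(𝔽_q)`** (any `nᵢ ≥ 2`, any finite fields): BCGPU 2023, Cor. 3.4 (type `A`),
the tree's `BCGPU2023_cor34_typeA_holds`. [cite: BlasiakCohnGrochowPrattUmans2023, Cor. 3.4] -/
theorem no_tppFamily_SL (k : ℕ → ℕ) (hk : ∀ i, 2 ≤ k i)
    (F : ℕ → Type) [∀ i, Field (F i)] [∀ i, Fintype (F i)] (n m p d : ℕ → ℕ)
    (h : ∀ i, RealizesTPP (Matrix.SpecialLinearGroup (Fin (k i)) (F i)) (n i) (m i) (p i))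
    (hd : ∀ i, maxCharDegree (Matrix.SpecialLinearGroup (Fin (k i)) (F i)) ≤ d i)
    (hd2 : ∀ i, 2 ≤ d i) (hlt : ∀ i, d i ^ 3 < n i * m i * p i)
    (hα : Tendsto (fun i => 3 * Real.log (Nat.card (Matrix.SpecialLinearGroup (Fin (k i)) (F i))) /
      Real.log ((n i * m i * p i : ℕ) : ℝ)) atTop (𝓝 2))
    (ho : Tendsto (fun i => (3 * Real.log (Nat.card (Matrix.SpecialLinearGroup (Fin (k i)) (F i))) /
        Real.log ((n i * m i * p i : ℕ) : ℝ) - 2) /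
        (Real.log (Nat.card (Matrix.SpecialLinearGroup (Fin (k i)) (F i))) / Real.log (d i) - 2))
        atTop (𝓝 0)) :
    False := by
  classical
  obtain ⟨ε, hε, hA⟩ := BCGPU2023_cor34_typeA_holds
  exact tppFamily_false_of_noCertificate (fun i => Matrix.SpecialLinearGroup (Fin (k i)) (F i))
    n m p d h hd hd2 hlt hα ho hε fun i S T U hTPP => (hA (F i) (k i) (hk i)).1 S T U hTPP

/-- **Not from `PSL_n(𝔽_q)`** (any `nᵢ ≥ 2`, any finite fields): BCGPU 2023, Cor. 3.4 (type `A`).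
[cite: BlasiakCohnGrochowPrattUmans2023, Cor. 3.4] -/
theorem no_tppFamily_PSL (k : ℕ → ℕ) (hk : ∀ i, 2 ≤ k i)
    (F : ℕ → Type) [∀ i, Field (F i)] [∀ i, Fintype (F i)] (n m p d : ℕ → ℕ)
    (h : ∀ i, RealizesTPP (Matrix.ProjectiveSpecialLinearGroup (Fin (k i)) (F i)) (n i) (m i) (p i))
    (hd : ∀ i, maxCharDegree (Matrix.ProjectiveSpecialLinearGroup (Fin (k i)) (F i)) ≤ d i)
    (hd2 : ∀ i, 2 ≤ d i) (hlt : ∀ i, d i ^ 3 < n i * m i * p i)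
    (hα : Tendsto (fun i => 3 * Real.log (Nat.card
        (Matrix.ProjectiveSpecialLinearGroup (Fin (k i)) (F i))) /
      Real.log ((n i * m i * p i : ℕ) : ℝ)) atTop (𝓝 2))
    (ho : Tendsto (fun i => (3 * Real.log (Nat.card
        (Matrix.ProjectiveSpecialLinearGroup (Fin (k i)) (F i))) /
        Real.log ((n i * m i * p i : ℕ) : ℝ) - 2) /
        (Real.log (Nat.card (Matrix.ProjectiveSpecialLinearGroup (Fin (k i)) (F i))) /
          Real.log (d i) - 2)) atTop (𝓝 0)) :
    False := by
  classical
  obtain ⟨ε, hε, hA⟩ := BCGPU2023_cor34_typeA_holds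
  exact tppFamily_false_of_noCertificate
    (fun i => Matrix.ProjectiveSpecialLinearGroup (Fin (k i)) (F i))
    n m p d h hd hd2 hlt hα ho hε fun i S T U hTPP => (hA (F i) (k i) (hk i)).2 S T U hTPP

/-- **Not from `SL_n(𝔽_q)^k` with `n ≥ 2` and `k ≥ 1` fixed** (the fields may vary): BCGPU 2023 §5,
the tree's `exists_eps_noCertificate_SL_pow`. [cite: BlasiakCohnGrochowPrattUmans2023, §5] -/
theorem no_tppFamily_SL_pow {ν : ℕ} (hν : 2 ≤ ν) {k : ℕ} (hk : 1 ≤ k)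
    (F : ℕ → Type) [∀ i, Field (F i)] [∀ i, Fintype (F i)] [∀ i, DecidableEq (F i)]
    (n m p d : ℕ → ℕ)
    (h : ∀ i, RealizesTPP (Fin k → Matrix.SpecialLinearGroup (Fin ν) (F i)) (n i) (m i) (p i))
    (hd : ∀ i, maxCharDegree (Fin k → Matrix.SpecialLinearGroup (Fin ν) (F i)) ≤ d i)
    (hd2 : ∀ i, 2 ≤ d i) (hlt : ∀ i, d i ^ 3 < n i * m i * p i)
    (hα : Tendsto (fun i => 3 * Real.log (Nat.card (Fin k → Matrix.SpecialLinearGroup (Fin ν) (F i))) /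
      Real.log ((n i * m i * p i : ℕ) : ℝ)) atTop (𝓝 2))
    (ho : Tendsto (fun i => (3 * Real.log (Nat.card (Fin k → Matrix.SpecialLinearGroup (Fin ν) (F i))) /
        Real.log ((n i * m i * p i : ℕ) : ℝ) - 2) /
        (Real.log (Nat.card (Fin k → Matrix.SpecialLinearGroup (Fin ν) (F i))) / Real.log (d i) - 2))
        atTop (𝓝 0)) :
    False := by
  obtain ⟨ε, hε, hP⟩ := exists_eps_noCertificate_SL_pow hν hk
  exact tppFamily_false_of_noCertificate (fun i => Fin k → Matrix.SpecialLinearGroup (Fin ν) (F i))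
    n m p d h hd hd2 hlt hα ho hε
    fun i S T U hTPP => hP (F i) S T U hTPP (2 + ε) (by linarith) le_rfl

/-- **Not from `SL_n(𝔽_q)^m` with `n ≥ 2` and `q` fixed** (the number of factors may vary):
Sawin's slice-rank bound for powers, the tree's `exists_eps_noCertificate_SL_pow_fixed_field_tpp`.
[cite: BlasiakCohnGrochowPrattUmans2023, §5] [cite: Sawin2018, Thm. 1.5] -/
theorem no_tppFamily_SL_pow_fixed_field {ν : ℕ} (hν : 2 ≤ ν)
    (F : Type) [Field F] [Fintype F] [DecidableEq F] (k : ℕ → ℕ) (n m p d : ℕ → ℕ)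
    (h : ∀ i, RealizesTPP (Fin (k i) → Matrix.SpecialLinearGroup (Fin ν) F) (n i) (m i) (p i))
    (hd : ∀ i, maxCharDegree (Fin (k i) → Matrix.SpecialLinearGroup (Fin ν) F) ≤ d i)
    (hd2 : ∀ i, 2 ≤ d i) (hlt : ∀ i, d i ^ 3 < n i * m i * p i)
    (hα : Tendsto (fun i => 3 * Real.log (Nat.card (Fin (k i) → Matrix.SpecialLinearGroup (Fin ν) F)) /
      Real.log ((n i * m i * p i : ℕ) : ℝ)) atTop (𝓝 2))
    (ho : Tendsto (fun i => (3 * Real.log (Nat.card (Fin (k i) → Matrix.SpecialLinearGroup (Fin ν) F)) /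
        Real.log ((n i * m i * p i : ℕ) : ℝ) - 2) /
        (Real.log (Nat.card (Fin (k i) → Matrix.SpecialLinearGroup (Fin ν) F)) / Real.log (d i) - 2))
        atTop (𝓝 0)) :
    False := by
  obtain ⟨ε, hε, hP⟩ := exists_eps_noCertificate_SL_pow_fixed_field_tpp F hν
  exact tppFamily_false_of_noCertificate (fun i => Fin (k i) → Matrix.SpecialLinearGroup (Fin ν) F)
    n m p d h hd hd2 hlt hα ho hε fun i S T U hTPP => hP (k i) S T U hTPP

/-- **Not from powers `H^k` of one fixed non-trivial group** (`k` may vary): Sawin 2018, Thm. 1.5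
(the tree's `Sawin2018_thm15_stpp`, one-member STPP family = a single TPP triple).
[cite: Sawin2018, Thm. 1.5] [cite: BlasiakChurchCohnGrochowNaslundSawinUmans2017, Thm. B] -/
theorem no_tppFamily_pow_fixed_group (H : Type) [Group H] [Fintype H] [DecidableEq H] [Nontrivial H]
    (k : ℕ → ℕ) (n m p d : ℕ → ℕ)
    (h : ∀ i, RealizesTPP (Fin (k i) → H) (n i) (m i) (p i))
    (hd : ∀ i, maxCharDegree (Fin (k i) → H) ≤ d i)
    (hd2 : ∀ i, 2 ≤ d i) (hlt : ∀ i, d i ^ 3 < n i * m i * p i)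
    (hα : Tendsto (fun i => 3 * Real.log (Nat.card (Fin (k i) → H)) /
      Real.log ((n i * m i * p i : ℕ) : ℝ)) atTop (𝓝 2))
    (ho : Tendsto (fun i => (3 * Real.log (Nat.card (Fin (k i) → H)) /
        Real.log ((n i * m i * p i : ℕ) : ℝ) - 2) /
        (Real.log (Nat.card (Fin (k i) → H)) / Real.log (d i) - 2)) atTop (𝓝 0)) :
    False := by
  obtain ⟨ε, hε, hP⟩ := Sawin2018_thm15_stpp H
  refine tppFamily_false_of_noCertificate (fun i => Fin (k i) → H) n m p d h hd hd2 hlt hα ho hε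
    fun i S T U hTPP => ?_
  have hS : SimultaneousTPP (fun _ : Fin 1 => S) (fun _ => T) (fun _ => U) :=
    ⟨fun _ => hTPP, fun a b c _ _ _ _ _ _ _ _ _ _ _ _ _ => ⟨Subsingleton.elim _ _, Subsingleton.elim _ _⟩⟩
  have := hP (k i) 1 (fun _ => S) (fun _ => T) (fun _ => U) hS
  simpa using this

end Exclusions

end Summit.MatrixMultiplication.MatrixMultiplication.Theorems

end
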